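import Summits.CriticalPhenomena.CardyFormulaZ2.Theorems.CardyBoundaryCoulombGasRectilinearCardyStubRowBlocksPart1
import Summits.CriticalPhenomena.CardyFormulaZ2.Theorems.CardyBoundaryCoulombGasRectilinearCardyStubClosureOneArm
import Summits.CriticalPhenomena.CardyFormulaZ2.Theorems.CardyBoundaryCoulombGasBoundaryDefectGaussianRStubTransportPathsPart4
import HarnessLib

/-!
# Stub B `stub_rowBlocks` of line `excursion-kernel-covariance`, part 6: the two index blocks from
# monotone feet, and the closest-arc rule away from the ends of an arc
# (crux `RectilinearCardy`, stmt-CriticalPhenomena-5660, route `CardyBoundaryCoulombGas`)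

Two layers of the ROW BLOCKS stub.

**Combinatorial layer** (no geometry): along one boundary cycle with indices `i < P` carrying
non-decreasing lifted feet `F i`, a set of indices ("attributed to the arc") that is located by the
feet — inside `(tb - ε, ta + ε)`, containing every row index with foot in `[tb + θ, ta - θ]`, and decided
EXACTLY inside the two end zones `|F - tb| < 2θ` (a suffix from `iA`) and `|F - ta| < 2θ` (a prefix up
to `iB`) — is the block `[iA, iB]` of row indices (`rb_block_arc`); the analogous statement for the
tail arc, whose zone at the origin dart wraps around the period, gives the block
`{0, 1} ∪ [iC, P)` (`rb_block_tail`).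

**Geometric layer** (the closest-arc rule AWAY from the ends of an arc `A = ∂D([α, β])`):
`rb_near_arc_of_attr` — a boundary-row vertex attributed to `A` is within `δ` of a point `∂D(t₁)`,
`t₁ ∈ [α, β]`; `rb_foot_window` — its lifted foot then lies within the tube tolerance of `t₁` modulo an
integer (`tp_tube`); `rb_attr_of_mid` — conversely a point `η`-close to `∂D(t₁)` with
`[t₁ - θ, t₁ + θ] ⊆ [α, β]` is attributed to `A` (points of `∂D ∖ A` have parameters `θ`-far from `t₁`,
hence are `m₂ ≥ 2η` away).

All [folklore].
-/

noncomputable section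

open Set Metric
open Literature.Probability.RandomPlanarGeometry
open Literature.Probability.LatticeModels (Site meshPoint Orient)

namespace Summit.CriticalPhenomena.CardyFormulaZ2.Cruxes.RectilinearCardy.ExcursionKernelCovariance

/-! ### The combinatorial layer: blocks from monotone feet -/

/-- **The arc block.** See the module docstring: the indices attributed to the arc form the block
`[iA, iB]` of row indices. [folklore] -/
theorem rb_block_arc {P iA iB : ℕ} {F : ℕ → ℝ} {InA Row : ℕ → Prop} {tb ta ε θ : ℝ}
    (hmono : Monotone F) (hεθ : ε ≤ θ) (hgap : tb + 4 * θ ≤ ta)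
    (hrow : ∀ i, InA i → Row i)
    (hrange : ∀ i < P, InA i → tb - ε < F i ∧ F i < ta + ε)
    (hmid : ∀ i < P, Row i → tb + θ ≤ F i → F i ≤ ta - θ → InA i)
    (hzb : ∀ i < P, |F i - tb| < 2 * θ → Row i ∧ (InA i ↔ iA ≤ i))
    (hza : ∀ i < P, |F i - ta| < 2 * θ → Row i ∧ (InA i ↔ i ≤ iB))
    (hFA : |F iA - tb| < ε) (hFB : |F iB - ta| < ε) :
    ∀ i < P, InA i ↔ iA ≤ i ∧ i ≤ iB ∧ Row i := by
  rw [abs_lt] at hFA hFB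
  have hε : 0 < ε := by linarith [hFA.1, hFA.2]
  intro i hi
  -- index comparisons from feet comparisons
  have hlt_of : ∀ a b, F a < F b → a < b := fun a b h => by
    by_contra hle; exact absurd (hmono (not_lt.1 hle)) (not_le.2 h)
  constructor
  · intro hA
    have hR := hrow i hA
    obtain ⟨h1, h2⟩ := hrange i hi hA
    by_cases hb : F i ≤ tb + θ
    · have hz : |F i - tb| < 2 * θ := by rw [abs_lt]; constructor <;> linarith
      refine ⟨((hzb i hi hz).2).1 hA, ?_, hR⟩
      exact (hlt_of i iB (by linarith)).le
    by_cases ha : ta - θ ≤ F i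
    · have hz : |F i - ta| < 2 * θ := by rw [abs_lt]; constructor <;> linarith
      refine ⟨?_, ((hza i hi hz).2).1 hA, hR⟩
      exact (hlt_of iA i (by linarith)).le
    rw [not_le] at hb ha
    exact ⟨(hlt_of iA i (by linarith)).le, (hlt_of i iB (by linarith)).le, hR⟩
  · rintro ⟨h1, h2, hR⟩
    have hF1 : F iA ≤ F i := hmono h1
    have hF2 : F i ≤ F iB := hmono h2
    by_cases hb : F i ≤ tb + θ
    · have hz : |F i - tb| < 2 * θ := by rw [abs_lt]; constructor <;> linarith
      exact ((hzb i hi hz).2).2 h1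
    by_cases ha : ta - θ ≤ F i
    · have hz : |F i - ta| < 2 * θ := by rw [abs_lt]; constructor <;> linarith
      exact ((hza i hi hz).2).2 h2
    rw [not_le] at hb ha
    exact hmid i hi hR hb.le ha.le

/-- **The tail block.** See the module docstring: the indices attributed to the tail arc (which ends
at the dart after the origin and starts again near the end of the period) are `{0, 1} ∪ [iC, P)` among
row indices. [folklore] -/
theorem rb_block_tail {P iC : ℕ} {F : ℕ → ℝ} {InT Row : ℕ → Prop} {tX tv td ε θ : ℝ}
    (hmono : Monotone F) (hεθ : 2 * ε ≤ θ) (htv : tX ≤ tv ∧ tv ≤ tX + ε)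
    (hrow : ∀ i, InT i → Row i)
    (hF0 : |F 0 - tX| < ε) (hF1 : |F 1 - tX| < ε) (hFP : F P = F 0 + 1)
    (hrange : ∀ i < P, InT i → F i < tv + ε ∨ td - ε < F i)
    (hmid : ∀ i < P, Row i → td + θ ≤ F i → F i ≤ tX + 1 - θ → InT i)
    (hzd : ∀ i < P, |F i - td| < 2 * θ → Row i ∧ (InT i ↔ iC ≤ i))
    (hzw0 : ∀ i < P, |F i - tX| < 2 * θ → Row i ∧ (InT i ↔ i ≤ 1))
    (hzw1 : ∀ i < P, |F i - (tX + 1)| < 2 * θ → Row i ∧ InT i)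
    (hFC : |F iC - td| < ε) :
    ∀ i < P, InT i ↔ (i ≤ 1 ∨ iC ≤ i) ∧ Row i := by
  rw [abs_lt] at hF0 hF1 hFC
  have hε : 0 < ε := by linarith [hF0.1, hF0.2]
  intro i hi
  have hlt_of : ∀ a b, F a < F b → a < b := fun a b h => by
    by_contra hle; exact absurd (hmono (not_lt.1 hle)) (not_le.2 h)
  have hFi0 : F 0 ≤ F i := hmono (Nat.zero_le i)
  have hFiP : F i ≤ F 0 + 1 := hFP ▸ hmono hi.le
  constructor
  · intro hT
    have hR := hrow i hT
    refine ⟨?_, hR⟩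
    rcases hrange i hi hT with h1 | h1
    · have hz : |F i - tX| < 2 * θ := by rw [abs_lt]; constructor <;> linarith
      exact Or.inl (((hzw0 i hi hz).2).1 hT)
    · right
      by_cases hd : F i < td + θ
      · have hz : |F i - td| < 2 * θ := by rw [abs_lt]; constructor <;> linarith
        exact ((hzd i hi hz).2).1 hT
      · exact (hlt_of iC i (by linarith)).le
  · rintro ⟨h1 | h1, hR⟩
    · have hz : |F i - tX| < 2 * θ := by
        interval_cases i
        · rw [abs_lt]; constructor <;> linarith
        · rw [abs_lt]; constructor <;> linarith
      exact ((hzw0 i hi hz).2).2 h1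
    · have hF1' : F iC ≤ F i := hmono h1
      by_cases hd : F i < td + θ
      · have hz : |F i - td| < 2 * θ := by rw [abs_lt]; constructor <;> linarith
        exact ((hzd i hi hz).2).2 h1
      by_cases hw : F i ≤ tX + 1 - θ
      · exact hmid i hi hR (not_lt.1 hd) hw
      · have hz : |F i - (tX + 1)| < 2 * θ := by rw [abs_lt]; constructor <;> linarith
        exact (hzw1 i hi hz).2

/-! ### The geometric layer: the closest-arc rule away from the ends of an arc -/

/-- **A boundary-row vertex attributed to an arc is within `δ` of a point of the arc**: the vertex is
within `δ` of `∂Ω` and at least as close to the arc as to `∂Ω`; the arc `∂D([α, β])` is compact, so the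
distance is attained. [folklore] -/
theorem rb_near_arc_of_attr (R : ConformalRectangle) (D : JordanDomain) {δ : ℝ} (hδ : 0 < δ) {y : Site 2}
    (hy : y ∈ boundaryRow R δ) {α β : ℝ} (hαβ : α ≤ β)
    (hattr : infDist (meshPoint δ y) (D.boundary '' Icc α β) ≤
      infDist (meshPoint δ y) (frontier R.carrier \ D.boundary '' Icc α β)) :
    ∃ t₁ ∈ Icc α β, dist (meshPoint δ y) (D.boundary t₁) ≤ δ := by
  have h1 : infDist (meshPoint δ y) (D.boundary '' Icc α β) ≤ δ := coa_infDist_le_of_attr_row R hδ hy hattr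
  have hc : IsCompact (D.boundary '' Icc α β) := isCompact_Icc.image D.continuous_boundary
  have hne : (D.boundary '' Icc α β).Nonempty := ⟨D.boundary α, α, ⟨le_rfl, hαβ⟩, rfl⟩
  obtain ⟨z, ⟨t₁, ht₁, rfl⟩, hz⟩ := hc.exists_infDist_eq_dist hne (meshPoint δ y)
  exact ⟨t₁, ht₁, by rw [← hz]; exact h1⟩

/-- **The lifted foot of a dart near an arc point lies near its parameter, modulo an integer**: if the
foot `∂D(Fi)` is `η`-close to the mesh point, which is `δ'`-close to `∂D(t₁)`, and `η + δ' < m₂` for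
the tube constant `m₂` of tolerance `ε`, then `|Fi - t₁ - n| < ε` for some integer `n`. [folklore] -/
theorem rb_foot_window (D : JordanDomain) {ε m₂ η δ' Fi t₁ : ℝ} {p : ℂ}
    (htube : ∀ s t : ℝ, (∀ n : ℤ, ε ≤ |s - t - n|) → m₂ ≤ dist (D.boundary s) (D.boundary t))
    (hF : dist (D.boundary Fi) p ≤ η) (hp : dist p (D.boundary t₁) ≤ δ') (hm : η + δ' < m₂) :
    ∃ n : ℤ, |Fi - t₁ - n| < ε := by
  by_contra hcon
  push Not at hcon
  have h1 := htube Fi t₁ hcon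
  have h2 := dist_triangle (D.boundary Fi) p (D.boundary t₁)
  linarith

/-- **Attribution away from the ends.** Let `A = ∂D([α, β])` and let `t₁` have
`[t₁ - θ, t₁ + θ] ⊆ [α, β]`, `ε ≤ θ`; let `m₂` be the tube constant of tolerance `ε` and `p` a point with
`dist p (∂D(t₁)) ≤ η`, `2η ≤ m₂`. Then `p` is at least as close to `A` as to `∂D ∖ A`: a point of `∂D ∖ A`
is `∂D(t)` with `t` at distance `≥ ε` from `t₁ + ℤ` (else `∂D(t) = ∂D(t - n) ∈ A`), hence at distance
`≥ m₂` from `∂D(t₁)` and `≥ m₂ - η ≥ η` from `p`. [folklore] -/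
theorem rb_attr_of_mid (D : JordanDomain) {α β ε θ m₂ η t₁ : ℝ} {p : ℂ} (hθ : 0 ≤ θ) (hεθ : ε ≤ θ)
    (hsub : α ≤ t₁ - θ ∧ t₁ + θ ≤ β)
    (htube : ∀ s t : ℝ, (∀ n : ℤ, ε ≤ |s - t - n|) → m₂ ≤ dist (D.boundary s) (D.boundary t))
    (hp : dist p (D.boundary t₁) ≤ η) (hm : 2 * η ≤ m₂) (hCne : (frontier D.carrier \ D.boundary '' Icc α β).Nonempty) :
    infDist p (D.boundary '' Icc α β) ≤ infDist p (frontier D.carrier \ D.boundary '' Icc α β) := by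
  have ht₁ : t₁ ∈ Icc α β := ⟨by linarith [hsub.1], by linarith [hsub.2]⟩
  calc infDist p (D.boundary '' Icc α β) ≤ dist p (D.boundary t₁) := infDist_le_dist_of_mem ⟨t₁, ht₁, rfl⟩
    _ ≤ η := hp
    _ ≤ infDist p (frontier D.carrier \ D.boundary '' Icc α β) := by
        refine (le_infDist hCne).2 fun z hz => ?_
        obtain ⟨hzf, hzA⟩ := hz
        rw [← D.range_boundary] at hzf
        obtain ⟨t, rfl⟩ := hzf
        have hfar : ∀ n : ℤ, ε ≤ |t - t₁ - n| := by
          intro n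
          by_contra hlt
          rw [not_le] at hlt
          apply hzA
          refine ⟨t - n, ⟨?_, ?_⟩, ?_⟩
          · rw [abs_lt] at hlt; linarith [hsub.1]
          · rw [abs_lt] at hlt; linarith [hsub.2]
          · have := D.periodic_boundary.sub_int_mul_eq n (x := t)
            rwa [mul_one] at this
        have h1 := htube t t₁ hfar
        have h2 := dist_triangle (D.boundary t) p (D.boundary t₁)
        rw [dist_comm (D.boundary t) p] at h2
        linarith

end Summit.CriticalPhenomena.CardyFormulaZ2.Cruxes.RectilinearCardy.ExcursionKernelCovariance

end
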